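import Summits.CriticalPhenomena.PercolationContinuityZ3.Theorems.PercNearOneGluingNoHeavyLowerTailStarSetHairAMGM
import HarnessLib

/-!
# `NoHeavyLowerTail` (stmt-CriticalPhenomena-4575) — two-word supply: the per-pair inequality of Step 2 (MWF-CERT §5) in coefficient form

Support file (prover `prim-gen-swap` gen 9; `--supports stmt-CriticalPhenomena-4575`).  No definitions, no named facts, no sorries.

Abstract per-star extreme coefficients `a x k ≥ 0` (`k : Fin 3`; `k = 0` unglued, `1`/`2` the two hairs) with the geometric-mean property
`a(x,0)²·θ_x ≤ a(x,1)·a(x,2)·(1−√θ_x)²` (supplied for the coefficients of `StarSet.extreme_regroup` by `StarSet.extremeCoeff_one_mul_two`).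
For three distinct stars `i, j, n` and hair choices `kᵢ, kⱼ, kₙ ∈ {1,2}` with complements `k̄`, the two COMPLEMENTARY words
`w₁ = (i↦kᵢ, j↦kⱼ, n↦kₙ, rest 0)`, `w₂ = (i↦k̄ᵢ, j↦k̄ⱼ, n↦k̄ₙ, rest 0)` satisfy (`W(e) := Π_x a(x, e x)`):

* `StarSet.two_word_coef_ge` — `W(w₁) + W(w₂) ≥ 2·W(0)·Π_{x∈{i,j,n}} √θ_x/(1−√θ_x)`;
* `StarSet.two_word_supply` — for a third class with stars `Nst ∌ i, j` and `Σ_{n∈Nst} √θ_n ≥ √θ_i`: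
  `8 θ_i θ_j · W(0) ≤ Σ_{n∈Nst} (W(w₁ n) + W(w₂ n))`.
This is the analytic half of Step 2 of the U0' supply proof; the other half is the 6-to-1 count (pair, i, j, n) ↦ word (gen 10).
-/

namespace Summit.CriticalPhenomena.PercolationContinuityZ3.Theorems

open Finset
open scoped BigOperators

namespace StarSet

variable {m : ℕ}

/-- Per star: `a₀·√θ/(1−√θ) ≤ √(a₁a₂)` from the squared geometric-mean property. [folklore] -/
theorem sqrt_hairs_ge (a0 a1 a2 θ : ℝ) (h0 : 0 ≤ a0) (h1 : 0 ≤ a1) (h2 : 0 ≤ a2) (hθ0 : 0 ≤ θ) (hθ1 : θ ≤ 1)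
    (hgm : a0 ^ 2 * θ ≤ a1 * a2 * (1 - Real.sqrt θ) ^ 2) :
    a0 * (Real.sqrt θ / (1 - Real.sqrt θ)) ≤ Real.sqrt (a1 * a2) := by
  have hs0 : 0 ≤ Real.sqrt θ := Real.sqrt_nonneg _
  have hs1 : Real.sqrt θ ≤ 1 := by
    have h := Real.sqrt_le_sqrt hθ1
    rwa [Real.sqrt_one] at h
  by_cases hlt : Real.sqrt θ < 1
  · have hd : 0 < 1 - Real.sqrt θ := by linarith
    rw [mul_div_assoc', div_le_iff₀ hd]
    have hL : 0 ≤ a0 * Real.sqrt θ := mul_nonneg h0 hs0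
    have hR : 0 ≤ Real.sqrt (a1 * a2) * (1 - Real.sqrt θ) := mul_nonneg (Real.sqrt_nonneg _) hd.le
    have hsq : (a0 * Real.sqrt θ) ^ 2 ≤ (Real.sqrt (a1 * a2) * (1 - Real.sqrt θ)) ^ 2 := by
      rw [mul_pow, mul_pow, Real.sq_sqrt hθ0, Real.sq_sqrt (mul_nonneg h1 h2)]
      exact hgm
    have h := Real.sqrt_le_sqrt hsq
    rwa [Real.sqrt_sq hL, Real.sqrt_sq hR] at h
  · have h1' : Real.sqrt θ = 1 := le_antisymm hs1 (not_lt.1 hlt)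
    rw [h1', sub_self, div_zero, mul_zero]
    exact Real.sqrt_nonneg _

/-- A star with `θ = 1` has vanishing unglued coefficient. [folklore] -/
theorem coef_zero_of_theta_one (a0 a1 a2 θ : ℝ) (h0 : 0 ≤ a0) (hθ : θ = 1)
    (hgm : a0 ^ 2 * θ ≤ a1 * a2 * (1 - Real.sqrt θ) ^ 2) : a0 = 0 := by
  rw [hθ, Real.sqrt_one, sub_self] at hgm
  have : a0 ^ 2 ≤ 0 := by simpa using hgm
  nlinarith

/-- Product of a function over all stars, three distinct stars pulled out. [folklore] -/
theorem prod_three_mul_rest (f : Fin m → ℝ) {i j n : Fin m} (hij : i ≠ j) (hin : i ≠ n) (hjn : j ≠ n) :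
    ∏ x, f x = f i * f j * f n * ∏ x ∈ univ \ {i, j, n}, f x := by
  rw [← prod_sdiff (subset_univ ({i, j, n} : Finset (Fin m))), prod_insert (by simp [hij, hin]), prod_pair hjn]
  ring

/-- **Two complementary words: `W(w₁) + W(w₂) ≥ 2·W(0)·Π √θ/(1−√θ)`.**  See the file header. [MWF-CERT.md §5 Step 2] -/
theorem two_word_coef_ge (a : Fin m → Fin 3 → ℝ) (θ : Fin m → ℝ) (ha : ∀ x k, 0 ≤ a x k)
    (hθ0 : ∀ x, 0 ≤ θ x) (hθ1 : ∀ x, θ x ≤ 1) (hgm : ∀ x, a x 0 ^ 2 * θ x ≤ a x 1 * a x 2 * (1 - Real.sqrt (θ x)) ^ 2)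
    {i j n : Fin m} (hij : i ≠ j) (hin : i ≠ n) (hjn : j ≠ n)
    (w₁ w₂ : Fin m → Fin 3) (hw0₁ : ∀ x, x ≠ i → x ≠ j → x ≠ n → w₁ x = 0) (hw0₂ : ∀ x, x ≠ i → x ≠ j → x ≠ n → w₂ x = 0)
    (hci : a i (w₁ i) * a i (w₂ i) = a i 1 * a i 2) (hcj : a j (w₁ j) * a j (w₂ j) = a j 1 * a j 2)
    (hcn : a n (w₁ n) * a n (w₂ n) = a n 1 * a n 2) :
    2 * (∏ x, a x 0) * ((Real.sqrt (θ i) / (1 - Real.sqrt (θ i))) * (Real.sqrt (θ j) / (1 - Real.sqrt (θ j))) *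
        (Real.sqrt (θ n) / (1 - Real.sqrt (θ n)))) ≤ (∏ x, a x (w₁ x)) + ∏ x, a x (w₂ x) := by
  set R : ℝ := ∏ x ∈ univ \ {i, j, n}, a x 0 with hR
  have hRnn : 0 ≤ R := prod_nonneg fun x _ => ha x 0
  have hrest₁ : ∏ x ∈ univ \ {i, j, n}, a x (w₁ x) = R :=
    prod_congr rfl fun x hx => by
      have hx' : x ∉ ({i, j, n} : Finset (Fin m)) := (mem_sdiff.1 hx).2
      simp only [mem_insert, mem_singleton, not_or] at hx'
      rw [hw0₁ x hx'.1 hx'.2.1 hx'.2.2]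
  have hrest₂ : ∏ x ∈ univ \ {i, j, n}, a x (w₂ x) = R :=
    prod_congr rfl fun x hx => by
      have hx' : x ∉ ({i, j, n} : Finset (Fin m)) := (mem_sdiff.1 hx).2
      simp only [mem_insert, mem_singleton, not_or] at hx'
      rw [hw0₂ x hx'.1 hx'.2.1 hx'.2.2]
  rw [prod_three_mul_rest (fun x => a x 0) hij hin hjn, prod_three_mul_rest (fun x => a x (w₁ x)) hij hin hjn,
    prod_three_mul_rest (fun x => a x (w₂ x)) hij hin hjn, hrest₁, hrest₂]
  -- AM–GM on the two words and the per-star geometric means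
  have hamgm := two_word_amgm (a i (w₁ i)) (a j (w₁ j)) (a n (w₁ n)) (a i (w₂ i)) (a j (w₂ j)) (a n (w₂ n))
    (ha _ _) (ha _ _) (ha _ _) (ha _ _) (ha _ _) (ha _ _)
  rw [hci, hcj, hcn] at hamgm
  have hi := sqrt_hairs_ge (a i 0) (a i 1) (a i 2) (θ i) (ha i 0) (ha i 1) (ha i 2) (hθ0 i) (hθ1 i) (hgm i)
  have hj := sqrt_hairs_ge (a j 0) (a j 1) (a j 2) (θ j) (ha j 0) (ha j 1) (ha j 2) (hθ0 j) (hθ1 j) (hgm j)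
  have hn := sqrt_hairs_ge (a n 0) (a n 1) (a n 2) (θ n) (ha n 0) (ha n 1) (ha n 2) (hθ0 n) (hθ1 n) (hgm n)
  have hci0 : 0 ≤ a i 0 * (Real.sqrt (θ i) / (1 - Real.sqrt (θ i))) := by
    refine mul_nonneg (ha i 0) ?_
    by_cases h : Real.sqrt (θ i) < 1
    · exact div_nonneg (Real.sqrt_nonneg _) (by linarith)
    · have : 1 - Real.sqrt (θ i) ≤ 0 := by linarith
      rcases this.lt_or_eq with hlt | heq
      · -- impossible: √θ ≤ 1
        have h1 : Real.sqrt (θ i) ≤ 1 := by have h := Real.sqrt_le_sqrt (hθ1 i); rwa [Real.sqrt_one] at h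
        linarith
      · rw [heq, div_zero]
  have hcj0 : 0 ≤ a j 0 * (Real.sqrt (θ j) / (1 - Real.sqrt (θ j))) := by
    refine mul_nonneg (ha j 0) ?_
    have h1 : Real.sqrt (θ j) ≤ 1 := by have h := Real.sqrt_le_sqrt (hθ1 j); rwa [Real.sqrt_one] at h
    rcases h1.lt_or_eq with hlt | heq
    · exact div_nonneg (Real.sqrt_nonneg _) (by linarith)
    · rw [heq, sub_self, div_zero]
  have hcn0 : 0 ≤ a n 0 * (Real.sqrt (θ n) / (1 - Real.sqrt (θ n))) := by
    refine mul_nonneg (ha n 0) ?_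
    have h1 : Real.sqrt (θ n) ≤ 1 := by have h := Real.sqrt_le_sqrt (hθ1 n); rwa [Real.sqrt_one] at h
    rcases h1.lt_or_eq with hlt | heq
    · exact div_nonneg (Real.sqrt_nonneg _) (by linarith)
    · rw [heq, sub_self, div_zero]
  have hprod : (a i 0 * (Real.sqrt (θ i) / (1 - Real.sqrt (θ i)))) * (a j 0 * (Real.sqrt (θ j) / (1 - Real.sqrt (θ j)))) *
      (a n 0 * (Real.sqrt (θ n) / (1 - Real.sqrt (θ n)))) ≤
      Real.sqrt (a i 1 * a i 2) * Real.sqrt (a j 1 * a j 2) * Real.sqrt (a n 1 * a n 2) :=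
    mul_le_mul (mul_le_mul hi hj hcj0 (Real.sqrt_nonneg _)) hn hcn0
      (mul_nonneg (Real.sqrt_nonneg _) (Real.sqrt_nonneg _))
  have key : 2 * ((a i 0 * (Real.sqrt (θ i) / (1 - Real.sqrt (θ i)))) * (a j 0 * (Real.sqrt (θ j) / (1 - Real.sqrt (θ j)))) *
      (a n 0 * (Real.sqrt (θ n) / (1 - Real.sqrt (θ n))))) ≤
      a i (w₁ i) * a j (w₁ j) * a n (w₁ n) + a i (w₂ i) * a j (w₂ j) * a n (w₂ n) := by linarith
  have key' := mul_le_mul_of_nonneg_right key hRnn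
  calc 2 * (a i 0 * a j 0 * a n 0 * R) * ((Real.sqrt (θ i) / (1 - Real.sqrt (θ i))) * (Real.sqrt (θ j) / (1 - Real.sqrt (θ j))) *
        (Real.sqrt (θ n) / (1 - Real.sqrt (θ n))))
      = 2 * ((a i 0 * (Real.sqrt (θ i) / (1 - Real.sqrt (θ i)))) * (a j 0 * (Real.sqrt (θ j) / (1 - Real.sqrt (θ j)))) *
          (a n 0 * (Real.sqrt (θ n) / (1 - Real.sqrt (θ n))))) * R := by ring
    _ ≤ (a i (w₁ i) * a j (w₁ j) * a n (w₁ n) + a i (w₂ i) * a j (w₂ j) * a n (w₂ n)) * R := key'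
    _ = a i (w₁ i) * a j (w₁ j) * a n (w₁ n) * R + a i (w₂ i) * a j (w₂ j) * a n (w₂ n) * R := by ring

/-- **Two-word supply summed over a third class.**  See the file header. [MWF-CERT.md §5 Step 2] -/
theorem two_word_supply (a : Fin m → Fin 3 → ℝ) (θ : Fin m → ℝ) (ha : ∀ x k, 0 ≤ a x k)
    (hθ0 : ∀ x, 0 ≤ θ x) (hθ1 : ∀ x, θ x ≤ 1) (hgm : ∀ x, a x 0 ^ 2 * θ x ≤ a x 1 * a x 2 * (1 - Real.sqrt (θ x)) ^ 2)
    {i j : Fin m} (hij : i ≠ j) (Nst : Finset (Fin m)) (hiN : i ∉ Nst) (hjN : j ∉ Nst)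
    (hS : Real.sqrt (θ i) ≤ ∑ n ∈ Nst, Real.sqrt (θ n))
    (w₁ w₂ : Fin m → Fin m → Fin 3)
    (hw0₁ : ∀ n ∈ Nst, ∀ x, x ≠ i → x ≠ j → x ≠ n → w₁ n x = 0) (hw0₂ : ∀ n ∈ Nst, ∀ x, x ≠ i → x ≠ j → x ≠ n → w₂ n x = 0)
    (hci : ∀ n ∈ Nst, a i (w₁ n i) * a i (w₂ n i) = a i 1 * a i 2) (hcj : ∀ n ∈ Nst, a j (w₁ n j) * a j (w₂ n j) = a j 1 * a j 2)
    (hcn : ∀ n ∈ Nst, a n (w₁ n n) * a n (w₂ n n) = a n 1 * a n 2) :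
    8 * θ i * θ j * ∏ x, a x 0 ≤ ∑ n ∈ Nst, ((∏ x, a x (w₁ n x)) + ∏ x, a x (w₂ n x)) := by
  have hA0 : 0 ≤ ∏ x, a x 0 := prod_nonneg fun x _ => ha x 0
  have hRHSnn : 0 ≤ ∑ n ∈ Nst, ((∏ x, a x (w₁ n x)) + ∏ x, a x (w₂ n x)) :=
    sum_nonneg fun n _ => add_nonneg (prod_nonneg fun x _ => ha _ _) (prod_nonneg fun x _ => ha _ _)
  -- degenerate stars (`θ = 1`) kill `W(0)`
  by_cases hdeg : ∃ x, θ x = 1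
  · obtain ⟨x, hx⟩ := hdeg
    have hx0 : a x 0 = 0 := coef_zero_of_theta_one (a x 0) (a x 1) (a x 2) (θ x) (ha x 0) hx (hgm x)
    have : ∏ y, a y 0 = 0 := prod_eq_zero (mem_univ x) hx0
    rw [this, mul_zero]; exact hRHSnn
  push Not at hdeg
  have hlt : ∀ x, θ x < 1 := fun x => lt_of_le_of_ne (hθ1 x) (hdeg x)
  have hslt : ∀ x, Real.sqrt (θ x) < 1 := fun x => by
    rw [Real.sqrt_lt' one_pos]; simpa using hlt x
  set c : Fin m → ℝ := fun x => Real.sqrt (θ x) / (1 - Real.sqrt (θ x)) with hc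
  have hcge : ∀ x, Real.sqrt (θ x) ≤ c x := fun x => by
    simp only [hc]
    rw [le_div_iff₀ (by linarith [hslt x])]
    nlinarith [Real.sqrt_nonneg (θ x), hslt x]
  -- per third star
  have hstep : ∀ n ∈ Nst, 2 * (∏ x, a x 0) * (c i * c j * c n) ≤ (∏ x, a x (w₁ n x)) + ∏ x, a x (w₂ n x) := by
    intro n hn
    have hin : i ≠ n := fun h => hiN (h ▸ hn)
    have hjn : j ≠ n := fun h => hjN (h ▸ hn)
    exact two_word_coef_ge a θ ha hθ0 hθ1 hgm hij hin hjn (w₁ n) (w₂ n) (hw0₁ n hn) (hw0₂ n hn) (hci n hn) (hcj n hn) (hcn n hn)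
  have hsum : 2 * (∏ x, a x 0) * (c i * c j) * ∑ n ∈ Nst, Real.sqrt (θ n) ≤
      ∑ n ∈ Nst, ((∏ x, a x (w₁ n x)) + ∏ x, a x (w₂ n x)) := by
    rw [mul_sum]
    refine sum_le_sum fun n hn => le_trans ?_ (hstep n hn)
    have hcc : 0 ≤ 2 * (∏ x, a x 0) * (c i * c j) :=
      mul_nonneg (mul_nonneg (by norm_num) hA0) (mul_nonneg (le_trans (Real.sqrt_nonneg _) (hcge i)) (le_trans (Real.sqrt_nonneg _) (hcge j)))
    calc 2 * (∏ x, a x 0) * (c i * c j) * Real.sqrt (θ n) ≤ 2 * (∏ x, a x 0) * (c i * c j) * c n :=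
          mul_le_mul_of_nonneg_left (hcge n) hcc
      _ = 2 * (∏ x, a x 0) * (c i * c j * c n) := by ring
  have hpair := pair_charge_le (θ i) (θ j) (∑ n ∈ Nst, Real.sqrt (θ n)) (hθ0 i) (hlt i) (hθ0 j) (hlt j) hS
  -- `8 θ_i θ_j ≤ 2 c_i c_j S`, times `W(0) ≥ 0`
  have h1 := mul_le_mul_of_nonneg_right hpair hA0
  calc 8 * θ i * θ j * ∏ x, a x 0 ≤ 2 * (Real.sqrt (θ i) / (1 - Real.sqrt (θ i))) * (Real.sqrt (θ j) / (1 - Real.sqrt (θ j))) *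
        (∑ n ∈ Nst, Real.sqrt (θ n)) * ∏ x, a x 0 := h1
    _ = 2 * (∏ x, a x 0) * (c i * c j) * ∑ n ∈ Nst, Real.sqrt (θ n) := by simp only [hc]; ring
    _ ≤ _ := hsum

end StarSet

end Summit.CriticalPhenomena.PercolationContinuityZ3.Theorems
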